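import Summits.BirchSwinnertonDyer.BirchSwinnertonDyer.Theorems.CMKolyvaginAtInertTwoLiftGroupsTwoSidedAtTwo
import Summits.BirchSwinnertonDyer.BirchSwinnertonDyer.Theorems.CMKolyvaginAtInertTwoThreadingAtTwo
import HarnessLib

/-!
# Route `CMKolyvaginAtInertTwo`, crux `CMKolyvaginExactAtInertTwo` (stmt-BirchSwinnertonDyer-24277):
# THE LIFT GROUPS WITH (IND) — UNCONDITIONAL, ALL FINITE SYMPLECTIC MODULES (T5′ CLOSED)

Seat `bsd-line-cmk2-p1` g14 (cell `bsd-print-cf2`); helper (`--supports stmt-BirchSwinnertonDyer-24277`).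
THEOREMS ONLY: no definition, no named fact, no `sorry`; no item is closed; BSD is not proved by this.

The two-sided reduction `exists_liftGroups_of_threading` (p685868) with its hypothesis `hthread`
DISCHARGED by the threading lemma `exists_threading` (`…ThreadingAtTwo`): in the abstract situation
of McCallum's Thm. 5.4 at `p = 2` over `ℚ` — `S₁ ↠π A` with kernel `⟨x⟩`, `x` of maximal order
(`S₁ = Sel_{2^M}(E/ℚ)`, `A = Ш(E/ℚ)[2^∞]`), nondegenerate alternating `ℚ/ℤ`-pairings on `A` and `S₂`
(`= Ш(E^{(d_K)}/ℚ)[2^∞]`; Cassels–Tate), both killed by `p^k`, injective `r₁ : S₁ → G`,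
`r₂ : S₂ → G` (`G = H¹(K, E[2^M])`) — there ALWAYS exist `Zp ≤ S₁`, `Zm ≤ S₂` with `Zp ∩ ⟨x⟩ = 0`,
`π(Zp)` and `Zm` isotropic of orders `√#A`, `√#S₂`, and **(IND) `r₁(Zp) ∩ r₂(Zm) = 0`**: the
hypotheses `hZp hZm hiso hind hIND` of the adaptive telescope
`KolyvaginPairDataTwo.card_mul_card_le_two_pow_of_pair` (p679105) up to the dictionary of
KERNEL-STATUS §13.2 (MEMO-T5prime-threading §1). T5′ of MEMO-T5 §4 is thereby a THEOREM for every
pair of finite symplectic modules; no arithmetic input is used.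

* `exists_liftGroups` — the statement above (any prime `p`).

References: [McCallumLMS1991] §5 Thm. 5.4 (p. 307); [Kolyvagin1989Izv] §3 (the pair `(E, E^D)` at `l = 2`).
-/

-- single-conjunct summit: `Summit.BirchSwinnertonDyer.BirchSwinnertonDyer.…` repeats the name by design
set_option linter.dupNamespace false
set_option autoImplicit false

noncomputable section

open AddSubgroup

namespace Summit.BirchSwinnertonDyer.BirchSwinnertonDyer.Theorems.KolyvaginLiftGroupsTwo

universe u v w

/-- **The lift groups with (IND), unconditional.** For `π : S₁ ↠ A` with kernel `⟨x⟩`,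
`ord x = exp S₁`; `B_A`, `B_B` alternating nondegenerate `ℚ/ℤ`-pairings on `A`, `S₂`; `p` prime with
`p^k · A = 0`, `p^k · S₂ = 0`; `r₁ : S₁ → G`, `r₂ : S₂ → G` injective: there are `Zp ≤ S₁`,
`Zm ≤ S₂` with `Disjoint ⟨x⟩ Zp`, `B_A(π Zp, π Zp) = 0`, `(#Zp)² = #A`, `B_B(Zm, Zm) = 0`,
`(#Zm)² = #S₂`, and `r₁ u = r₂ v ⟹ u = 0 ∧ v = 0` on `Zp × Zm`.
[cite: McCallumLMS1991, §5 Thm. 5.4 (proof, p. 307: the maximal isotropic subgroup D)] -/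
theorem exists_liftGroups {G : Type w} [AddCommGroup G] {S₁ : Type u} [AddCommGroup S₁] [Finite S₁]
    {S₂ : Type u} [AddCommGroup S₂] [Finite S₂] {A : Type v} [AddCommGroup A]
    {p : ℕ} (hp : p.Prime)
    (π : S₁ →+ A) (hπ : Function.Surjective π) (x : S₁)
    (hker : π.ker = zmultiples x) (hx : addOrderOf x = AddMonoid.exponent S₁)
    (BA : A →+ A →+ AddCircle (1 : ℚ)) (hAalt : ∀ a, BA a a = 0)
    (hAnd : ∀ a, (∀ b, BA a b = 0) → a = 0)
    (BB : S₂ →+ S₂ →+ AddCircle (1 : ℚ)) (hBalt : ∀ v, BB v v = 0)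
    (hBnd : ∀ v, (∀ w, BB v w = 0) → v = 0) {k : ℕ} (hpA : ∀ a : A, p ^ k • a = 0)
    (hpB : ∀ v : S₂, p ^ k • v = 0)
    (r₁ : S₁ →+ G) (r₂ : S₂ →+ G) (hr₁ : Function.Injective r₁) (hr₂ : Function.Injective r₂) :
    ∃ (Zp : AddSubgroup S₁) (Zm : AddSubgroup S₂),
      Disjoint (zmultiples x) Zp ∧
      (∀ a ∈ Zp, ∀ b ∈ Zp, BA (π a) (π b) = 0) ∧ Nat.card Zp ^ 2 = Nat.card A ∧
      (∀ v ∈ Zm, ∀ w ∈ Zm, BB v w = 0) ∧ Nat.card Zm ^ 2 = Nat.card S₂ ∧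
      (∀ u ∈ Zp, ∀ v ∈ Zm, r₁ u = r₂ v → u = 0 ∧ v = 0) :=
  exists_liftGroups_of_threading hp (fun C _ _ P Q a b hCp hPa hQa hH ↦
      exists_threading hp C P Q a b hCp hPa hQa hH)
    π hπ x hker hx BA hAalt hAnd BB hBalt hBnd hpA hpB r₁ r₂ hr₁ hr₂

end Summit.BirchSwinnertonDyer.BirchSwinnertonDyer.Theorems.KolyvaginLiftGroupsTwo

end
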